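import Literature.AlgebraicTopology.SingularHomology.PoincareDuality
import Literature.AlgebraicTopology.SingularHomology.UniversalCoefficients
import Mathlib.AlgebraicTopology.FundamentalGroupoid.SimplyConnected
import HarnessLib

/-!
# Highly connected closed manifolds are homology spheres (Poincaré duality + universal coefficients)

Topic `Literature/AlgebraicTopology/SingularHomology` (trunk G04 AlgTop: `Literature.AlgebraicTopology.SingularHomology.singularHomology`,
`Literature.AlgebraicTopology.SingularHomology.singularCohomology`, `Literature.AlgebraicTopology.SingularHomology.kroneckerPairing`, `Literature.AlgebraicTopology.SingularHomology.HomologicalOrientation`,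
`Literature.AlgebraicTopology.SingularHomology.poincareDualityMap`). The algebraic-topology step of Micallef–Moore's sphere theorem as
printed by Abresch–Meyer (*Comparison Geometry*, MSRI Publ. 30 (1997), p. 11): once
`H₁(Mⁿ; ℤ) = ⋯ = H_{⌊n/2⌋}(Mⁿ; ℤ) = 0`, "by the Poincaré duality theorem `Mⁿ` must be a homology
sphere". Spelled out (Hatcher, *Algebraic Topology* (2002), §3.3 Thm. 3.30 and §3.1 Thm. 3.2 with
p. 196): for `⌊n/2⌋ < k < n` put `p = n - k`, so `1 ≤ p ≤ ⌊n/2⌋`; then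
`H_k(M; ℤ) ≅ Hᵖ(M; ℤ)` (Poincaré duality, `M` closed and `ℤ`-oriented) and
`0 → Ext(H_{p-1}(M), ℤ) → Hᵖ(M; ℤ) → Hom(H_p(M), ℤ) → 0` with `H_p(M) = 0` and `H_{p-1}(M)` free
(`= 0` for `p ≥ 2`, `= H₀(M) ≅ ℤ` for `p = 1`), whence `Hᵖ(M; ℤ) = 0` and `H_k(M; ℤ) = 0`.

This file

* vendors one more consequence of the universal coefficient theorem as a **named fact**
  (D-0014), next to `Literature.AlgebraicTopology.SingularHomology.kroneckerMap_surjective` and `Literature.AlgebraicTopology.SingularHomology.ker_kroneckerMap_le_torsion` of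
  `UniversalCoefficients.lean`: `Literature.AlgebraicTopology.SingularHomology.injective_kroneckerMap_of_free` — if `Hₙ(X; R)` is a free
  `R`-module then the Kronecker map `h : Hⁿ⁺¹(X; R) → Hom_R(Hₙ₊₁(X; R), R)` is injective
  (Hatcher Thm. 3.2: `ker h = Ext(Hₙ(X), G)`; p. 196: "`Ext(H, G) = 0` if `H` is free"; p. 197:
  verbatim over a principal ideal domain);
* PROVES `Literature.AlgebraicTopology.SingularHomology.isZero_singularCohomology_of_isZero_of_free` (`H_p = 0`, `H_{p-1}` free
  `⇒ Hᵖ = 0`), `Literature.AlgebraicTopology.SingularHomology.isZero_singularHomology_of_isZero_of_two_mul_le` (the duality step above: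
  a closed connected `ℤ`-oriented `n`-manifold with `H_k(M; ℤ) = 0` for `1 ≤ k ≤ n/2` has
  `H_k(M; ℤ) = 0` for all `0 < k < n`) and the packaged form
  `Literature.AlgebraicTopology.SingularHomology.isHomologySphere_of_isZero_of_two_mul_le` (such an `M` has the integral homology of `Sⁿ`:
  `H_k = 0` for `0 < k ≠ n`, `Hₙ ≅ ℤ`), relative to the tree's named facts
  `Literature.AlgebraicTopology.SingularHomology.bijective_poincareDualityMap` (Hatcher Thm. 3.30), `Literature.AlgebraicTopology.SingularHomology.nonempty_singularHomology_top_iso`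
  (Thm. 3.26(a)) and `Literature.AlgebraicTopology.SingularHomology.isZero_singularHomology_of_lt` (Thm. 3.26(c) / Prop. 3.29);
* defines the predicate `Literature.AlgebraicTopology.SingularHomology.IsHomologySphere M n`
  ("`M` has the (integral) homology of the `n`-sphere" — the hypothesis of Milnor, *Lectures on
  the h-cobordism theorem* (1965), §9, Prop. B, p. 109) used to state Smale's theorem in Milnor's
  form (`Literature/Topology/FourManifolds/`) and consumed by
  `Literature/Geometry/Riemannian/MicallefMooreProofs.lean`. It is a NOTION (a predicate in the
  explicit parameters `M`, `n`), not a named fact: its universal closure is false — a point is not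
  a homology `n`-sphere for `n ≥ 1` (`not_isHomologySphere_of_subsingleton`, from Hatcher
  Prop. 2.8, `Hₙ(pt) = 0`), while the unit sphere `Sⁿ ⊆ ℝⁿ⁺¹`, `n ≥ 1`, is one (Hatcher Cor. 2.14;
  proved in the sibling `HomologySpheresProofs.lean` from the tree's sphere computations).

## References

* A. Hatcher, *Algebraic Topology*, CUP (2002): §3.1 Thm. 3.2 (p. 195), p. 196 ("`Ext(H, G) = 0`
  if `H` is free"), p. 197 (PIDs); §3.3 Thm. 3.26, Prop. 3.29, Thm. 3.30. [HatcherAT2002]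
* U. Abresch, W. T. Meyer, *Injectivity radius estimates and sphere theorems*, Comparison
  Geometry, MSRI Publ. 30 (1997), p. 11. [AbreschMeyer1997]
* J. Milnor, *Lectures on the h-cobordism theorem*, Princeton (1965), §9, Prop. B (p. 109).
  [MilnorHCobordism1965]
-/

noncomputable section

open CategoryTheory Limits

universe u v

namespace Literature.AlgebraicTopology.SingularHomology

/-! ### Universal coefficients: the Kronecker map is injective when `Hₙ₋₁` is free -/

section UCT

variable (R : Type v) [CommRing R] (X : Type u) [TopologicalSpace X]

/-- **Universal coefficients, injectivity of the Kronecker map over a free `Hₙ`** (Hatcher 2002,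
§3.1, Thm. 3.2, p. 195: the sequence `0 → Ext(Hₙ(C), G) → Hⁿ⁺¹(C; G) —h→ Hom(Hₙ₊₁(C), G) → 0`
is (split) exact for a chain complex `C` of free modules, applied to singular chains pp. 198–199;
p. 196: "`Ext(H, G) = 0` if `H` is free"; p. 197: the same over a principal ideal domain `R`
with `Hom_R`, `Ext_R`).  **Vendored consequence:** for `R` a PID, if `Hₙ(X; R)` is a free
`R`-module then the Kronecker map `h : Hⁿ⁺¹(X; R) → Hom_R(Hₙ₊₁(X; R), R)`, `a ↦ ⟨a, ·⟩`
(`Literature.kroneckerPairing R R X (n + 1)`), is injective (`ker h = Ext_R(Hₙ(X; R), R) = 0`).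
Companion of `Literature.AlgebraicTopology.SingularHomology.kroneckerMap_surjective` and `Literature.AlgebraicTopology.SingularHomology.ker_kroneckerMap_le_torsion`
(`UniversalCoefficients.lean`); not in Mathlib (no universal coefficient theorem). Named fact;
users take `(h : injective_kroneckerMap_of_free R X n)` (the freeness hypothesis is an explicit
argument of the `Prop`, not an instance binder). [cite: HatcherAT2002, §3.1 Thm. 3.2 (p. 195), p. 196, p. 197] -/
def injective_kroneckerMap_of_free [IsDomain R] [IsPrincipalIdealRing R] (n : ℕ) : Prop :=
  Module.Free R (singularHomology R R X n) →
    Function.Injective (kroneckerPairing R R X (n + 1))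

variable {R X}

/-- **`Hₙ₊₁(X; R) = 0` and `Hₙ(X; R)` free imply `Hⁿ⁺¹(X; R) = 0`** (Hatcher 2002, §3.1,
Thm. 3.2 with p. 196: `Hⁿ⁺¹ ≅ Hom(Hₙ₊₁, R) ⊕ Ext(Hₙ, R) = 0`). From the named fact
`injective_kroneckerMap_of_free R X n`: `h` embeds `Hⁿ⁺¹(X; R)` into `Hom_R(0, R) = 0`.
[cite: HatcherAT2002, §3.1 Thm. 3.2 and p. 196] -/
theorem isZero_singularCohomology_of_isZero_of_free [IsDomain R] [IsPrincipalIdealRing R] {n : ℕ}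
    (hU : injective_kroneckerMap_of_free R X n) (hF : Module.Free R (singularHomology R R X n))
    (hZ : IsZero (singularHomology R R X (n + 1))) :
    IsZero (singularCohomology R R X (n + 1)) := by
  haveI : Subsingleton (singularHomology R R X (n + 1)) := ModuleCat.subsingleton_of_isZero hZ
  have hinj : Function.Injective (kroneckerPairing R R X (n + 1)) := hU hF
  haveI : Subsingleton (singularCohomology R R X (n + 1)) := hinj.subsingleton
  exact ModuleCat.isZero_iff_subsingleton.mpr inferInstance

end UCT

/-! ### Homology spheres -/

section HomologySphere

/-- **`M` has the (integral) homology of the `n`-sphere** — DEFINITION of the notion "homology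
`n`-sphere" (Milnor, *Lectures on the h-cobordism theorem* (1965), §9, Prop. B, p. 109: "a closed
simply-connected smooth manifold with the (integral) homology of the `n`-sphere `Sⁿ`"; Hatcher
2002, Cor. 2.14: `Hₖ(Sⁿ) = 0` for `0 < k ≠ n`, `Hₙ(Sⁿ) ≅ ℤ`, `n ≥ 1`): the positive-degree
singular homology `Hₖ(M; ℤ)` (`Literature.AlgebraicTopology.SingularHomology.singularHomology ℤ ℤ M k`)
vanishes for `k ≠ n` and `Hₙ(M; ℤ) ≅ ℤ`. Degree `0` is not constrained (for the path-connected
spaces this is applied to, `H₀(M; ℤ) ≅ ℤ = H₀(Sⁿ; ℤ)` by Hatcher Prop. 2.7,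
`Literature.AlgebraicTopology.SingularHomology.singularHomology.isIso_ε_of_pathConnectedSpace`);
meaningful for `n ≥ 1`. A predicate in the explicit parameters `M`, `n` — not an assertion: it
fails for a point (`not_isHomologySphere_of_subsingleton`) and holds for `Sⁿ`, `n ≥ 1`
(`isHomologySphere_sphere` in `HomologySpheresProofs.lean`). [cite: MilnorHCobordism1965, §9 Prop. B (p. 109)] [cite: HatcherAT2002, Cor. 2.14] -/
def IsHomologySphere (M : Type u) [TopologicalSpace M] (n : ℕ) : Prop :=
  (∀ k : ℕ, 0 < k → k ≠ n → IsZero (singularHomology ℤ ℤ M k)) ∧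
    Nonempty (singularHomology ℤ ℤ M n ≅ ModuleCat.of ℤ (ULift.{u} ℤ))

variable {M : Type u} [TopologicalSpace M] {n : ℕ}

/-- Unfolding `IsHomologySphere`. [folklore] -/
lemma isHomologySphere_iff :
    IsHomologySphere M n ↔
      (∀ k : ℕ, 0 < k → k ≠ n → IsZero (singularHomology ℤ ℤ M k)) ∧
        Nonempty (singularHomology ℤ ℤ M n ≅ ModuleCat.of ℤ (ULift.{u} ℤ)) :=
  Iff.rfl

/-- A homology `n`-sphere has `Hₖ(M; ℤ) = 0` for `0 < k < n`. [folklore] -/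
lemma IsHomologySphere.isZero_of_lt (h : IsHomologySphere M n) {k : ℕ} (hk : 0 < k)
    (hkn : k < n) : IsZero (singularHomology ℤ ℤ M k) :=
  h.1 k hk hkn.ne

/-- A homology `n`-sphere has `Hₖ(M; ℤ) = 0` for `k > n`. [folklore] -/
lemma IsHomologySphere.isZero_of_gt (h : IsHomologySphere M n) {k : ℕ} (hnk : n < k) :
    IsZero (singularHomology ℤ ℤ M k) :=
  h.1 k (lt_of_le_of_lt n.zero_le hnk) hnk.ne'

/-- A homology `n`-sphere has `Hₙ(M; ℤ) ≅ ℤ`. [folklore] -/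
lemma IsHomologySphere.nonempty_iso (h : IsHomologySphere M n) :
    Nonempty (singularHomology ℤ ℤ M n ≅ ModuleCat.of ℤ (ULift.{u} ℤ)) :=
  h.2

/-- **A point is not a homology `n`-sphere for `n ≥ 1`**: `Hₙ(pt; ℤ) = 0` for `n > 0` (Hatcher
2002, Prop. 2.8; tree: `isZero_singularHomology_of_subsingleton`), whereas a homology `n`-sphere
has `Hₙ ≅ ℤ ≠ 0`. In particular the universal closure `∀ M n, IsHomologySphere M n` of the
predicate is false: `IsHomologySphere` is a notion, not a named fact. [cite: HatcherAT2002, Prop. 2.8] -/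
theorem not_isHomologySphere_of_subsingleton [Subsingleton M] (hn : n ≠ 0) :
    ¬ IsHomologySphere M n := by
  rintro ⟨-, ⟨e⟩⟩
  have hZ : IsZero (ModuleCat.of ℤ (ULift.{u} ℤ)) :=
    (isZero_singularHomology_of_subsingleton ℤ ℤ (X := M) hn).of_iso e.symm
  haveI : Subsingleton (ULift.{u} ℤ) := ModuleCat.subsingleton_of_isZero hZ
  exact one_ne_zero (ULift.up_injective (Subsingleton.elim (ULift.up (1 : ℤ)) (ULift.up 0)))

/-- The universal closure of the predicate `IsHomologySphere` is false (witness: the one-point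
space in degree `1`), recording that `IsHomologySphere` is a definition and admits no
`IsHomologySphere_holds`. [folklore] -/
theorem not_forall_isHomologySphere :
    ¬ ∀ (M : Type u) [TopologicalSpace M] (n : ℕ), IsHomologySphere M n :=
  fun h => not_isHomologySphere_of_subsingleton (M := PUnit.{u + 1}) (n := 1) one_ne_zero (h _ 1)

end HomologySphere

/-! ### The duality step: `H_k = 0` up to the middle dimension forces a homology sphere -/

section Duality

variable {X : Type u} [TopologicalSpace X] {n : ℕ}

/-- `H₀(X; ℤ)` of a path-connected space is a free `ℤ`-module (`H₀(X; ℤ) ≅ ℤ`, Hatcher 2002,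
Prop. 2.7; tree: `Literature.AlgebraicTopology.SingularHomology.singularHomology.isIso_ε_of_pathConnectedSpace`). [cite: HatcherAT2002, Prop. 2.7] -/
theorem free_singularHomology_zero [PathConnectedSpace X] :
    Module.Free ℤ (singularHomology ℤ ℤ X 0) := by
  haveI := singularHomology.isIso_ε_of_pathConnectedSpace ℤ ℤ (X := X)
  exact Module.Free.of_equiv (asIso (singularHomology.ε ℤ ℤ X)).toLinearEquiv.symm

/-- **The Poincaré-duality step** (Abresch–Meyer 1997, p. 11: with `H₁ = ⋯ = H_{⌊n/2⌋} = 0`,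
"by the Poincaré duality theorem `Mⁿ` must be a homology sphere"; Hatcher 2002, Thm. 3.30 and
Thm. 3.2 with p. 196). Let `X` be a closed (compact Hausdorff) path-connected topological
`n`-manifold with a `ℤ`-orientation `μ`, and assume the named facts Poincaré duality for `μ`
(`hPD`, Hatcher Thm. 3.30) and universal coefficients in the form
`injective_kroneckerMap_of_free` (`hU`, Hatcher Thm. 3.2). If `H_k(X; ℤ) = 0` for all
`1 ≤ k ≤ n/2`, then `H_k(X; ℤ) = 0` for all `0 < k < n`: for `n/2 < k < n` write `n = p + k`
with `1 ≤ p ≤ n/2`; `H_p = 0` and `H_{p-1}` is free (`H₀ ≅ ℤ`, or zero), so `Hᵖ(X; ℤ) = 0`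
(`isZero_singularCohomology_of_isZero_of_free`), and `Hᵖ(X; ℤ) ≅ H_k(X; ℤ)` by duality.
[cite: AbreschMeyer1997, p. 11] [cite: HatcherAT2002, Thm. 3.30, Thm. 3.2 and p. 196] -/
theorem isZero_singularHomology_of_isZero_of_two_mul_le [CompactSpace X] [T2Space X]
    [ChartedSpace (EuclideanSpace ℝ (Fin n)) X] [PathConnectedSpace X]
    (μ : HomologicalOrientation ℤ X n)
    (hPD : ∀ (p q : ℕ) (h : p + q = n), bijective_poincareDualityMap μ h)
    (hU : ∀ k : ℕ, injective_kroneckerMap_of_free ℤ X k)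
    (hX : ∀ k : ℕ, 0 < k → 2 * k ≤ n → IsZero (singularHomology ℤ ℤ X k))
    {k : ℕ} (hk : 0 < k) (hkn : k < n) : IsZero (singularHomology ℤ ℤ X k) := by
  by_cases h2 : 2 * k ≤ n
  · exact hX k hk h2
  -- `n = (p' + 1) + k` with `2 (p' + 1) ≤ n`
  obtain ⟨p', rfl⟩ : ∃ p' : ℕ, n = p' + 1 + k := ⟨n - k - 1, by omega⟩
  have h2p : 2 * (p' + 1) ≤ p' + 1 + k := by omega
  -- `H_{p'}` is free: `H₀ ≅ ℤ`, or zero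
  have hF : Module.Free ℤ (singularHomology ℤ ℤ X p') := by
    rcases Nat.eq_zero_or_pos p' with rfl | hp'
    · exact free_singularHomology_zero
    · haveI : Subsingleton (singularHomology ℤ ℤ X p') :=
        ModuleCat.subsingleton_of_isZero (hX p' hp' (by omega))
      exact Module.Free.of_subsingleton ℤ _
  -- hence `H^{p'+1} = 0`
  have hC : IsZero (singularCohomology ℤ ℤ X (p' + 1)) :=
    isZero_singularCohomology_of_isZero_of_free (hU p') hF (hX (p' + 1) p'.succ_pos h2p)
  haveI : Subsingleton (singularCohomology ℤ ℤ X (p' + 1)) := ModuleCat.subsingleton_of_isZero hC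
  -- and `H^{p'+1} ≅ H_k` by Poincaré duality
  have e := poincareDualityEquiv μ rfl (hPD (p' + 1) k rfl)
  haveI : Subsingleton (singularHomology ℤ ℤ X k) := e.symm.injective.subsingleton
  exact ModuleCat.isZero_iff_subsingleton.mpr inferInstance

/-- **Highly connected closed oriented manifolds are homology spheres.** Let `X` be a closed
connected topological `n`-manifold, `n ≥ 1`, with a `ℤ`-orientation `μ`; assume Poincaré duality
for `μ` (`hPD`, Hatcher Thm. 3.30), universal coefficients (`hU`, Thm. 3.2), `Hₙ(X; ℤ) ≅ ℤ`
(`hT`, Thm. 3.26(a)) and `H_k(X; ℤ) = 0` for `k > n` (`hgt`, Thm. 3.26(c) / Prop. 3.29) — all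
named facts of the tree. If `H_k(X; ℤ) = 0` for `1 ≤ k ≤ n/2`, then `X` has the integral
homology of `Sⁿ` (Abresch–Meyer 1997, p. 11). [cite: AbreschMeyer1997, p. 11] [cite: HatcherAT2002, Thm. 3.26, Thm. 3.30, Thm. 3.2] -/
theorem isHomologySphere_of_isZero_of_two_mul_le [CompactSpace X] [T2Space X]
    [ChartedSpace (EuclideanSpace ℝ (Fin n)) X] [PathConnectedSpace X]
    (μ : HomologicalOrientation ℤ X n)
    (hPD : ∀ (p q : ℕ) (h : p + q = n), bijective_poincareDualityMap μ h)
    (hU : ∀ k : ℕ, injective_kroneckerMap_of_free ℤ X k)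
    (hT : nonempty_singularHomology_top_iso (R := ℤ) (X := X) (n := n))
    (hgt : isZero_singularHomology_of_lt ℤ ℤ (X := X) (n := n))
    (hX : ∀ k : ℕ, 0 < k → 2 * k ≤ n → IsZero (singularHomology ℤ ℤ X k)) :
    IsHomologySphere X n := by
  haveI : ConnectedSpace X := inferInstance
  refine ⟨fun k hk hkn => ?_, hT μ⟩
  rcases lt_or_gt_of_ne hkn with hlt | hgt'
  · exact isZero_singularHomology_of_isZero_of_two_mul_le μ hPD hU hX hk hlt
  · exact hgt hgt'

/-- **Simply connected version.** A closed simply connected topological `n`-manifold with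
`H_k(X; ℤ) = 0` for `1 ≤ k ≤ n/2` has the integral homology of `Sⁿ`, GIVEN the tree's named
facts: `ℤ`-orientability of simply connected manifolds (`hO`, Hatcher Prop. 3.25), Poincaré
duality (`hPD`, Thm. 3.30), universal coefficients (`hU`, Thm. 3.2), `Hₙ ≅ ℤ` (`hT`,
Thm. 3.26(a)) and vanishing above the dimension (`hgt`, Thm. 3.26(c)). This is the form in which
the step enters Micallef–Moore's proof (Abresch–Meyer 1997, p. 11). [cite: AbreschMeyer1997, p. 11] [cite: HatcherAT2002, Prop. 3.25, Thm. 3.26, Thm. 3.30, Thm. 3.2] -/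
theorem isHomologySphere_of_isZero_of_two_mul_le_of_simplyConnectedSpace [CompactSpace X]
    [T2Space X] [ChartedSpace (EuclideanSpace ℝ (Fin n)) X] [SimplyConnectedSpace X]
    (hO : isOrientableOver_int_of_simplyConnectedSpace (X := X))
    (hPD : ∀ (μ : HomologicalOrientation ℤ X n) (p q : ℕ) (h : p + q = n),
      bijective_poincareDualityMap μ h)
    (hU : ∀ k : ℕ, injective_kroneckerMap_of_free ℤ X k)
    (hT : nonempty_singularHomology_top_iso (R := ℤ) (X := X) (n := n))
    (hgt : isZero_singularHomology_of_lt ℤ ℤ (X := X) (n := n))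
    (hX : ∀ k : ℕ, 0 < k → 2 * k ≤ n → IsZero (singularHomology ℤ ℤ X k)) :
    IsHomologySphere X n := by
  obtain ⟨μ⟩ : IsOrientableOver ℤ X n := hO
  exact isHomologySphere_of_isZero_of_two_mul_le μ (hPD μ) hU hT hgt hX

end Duality

end Literature.AlgebraicTopology.SingularHomology

end
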